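import Mathlib
import Summits.AtomisticToContinuum.FouriersLaw.Theses.JunctionLocality
import Summits.AtomisticToContinuum.FouriersLaw.Theorems.JunctionLocalitySuperadditiveResistanceDeviceLiouville
import Summits.AtomisticToContinuum.FouriersLaw.Theorems.JunctionLocalitySuperadditiveResistanceStubPlainForwardField
import Summits.AtomisticToContinuum.FouriersLaw.Theorems.JunctionLocalitySuperadditiveResistanceStubKappaFrame
import Summits.AtomisticToContinuum.FouriersLaw.Theorems.JunctionLocalitySuperadditiveResistanceStubPlainKuboLink
import Summits.AtomisticToContinuum.FouriersLaw.Theorems.JunctionLocalitySuperadditiveResistanceStubTerminationLocalityAux8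
import Summits.AtomisticToContinuum.FouriersLaw.Theorems.JunctionLocalitySuperadditiveResistanceStubBypassBoundAux5
import Summits.AtomisticToContinuum.FouriersLaw.Theorems.JunctionLocalitySuperadditiveResistanceStubProbeRemovalCostAux6

/-!
# Crux `SuperadditiveResistance` — line `floating-probe-bypass-laplacian`, skeleton v9 (κ-FRAME, FULLY IRREDUCIBLE FORM)
# (lead c3, 2026-08-16; v7 by lead -1 / c2, v6 by lead -b-0)

v9 keeps the κ-frame composition of v7 verbatim and changes WHAT IS REGISTERED: the three legs S1' (termination
locality), S2' (bypass bound) and S3' (probe-removal cost) of v7 are no longer stubs but THEOREMS of this file, derived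
from three new stubs that ARE their lossless reduced forms, landed meanwhile as reduction theorems:

* S1'' `stub_terminationFluctuationBound` — the FLUCTUATION BOUND at the γ-bathed end of the left block
  (`(G_N/γ)K₀₁ − (γ²/T²)(S_N + Dyn_N^{fl}(κ)) ≤ C' G_N K₀₀` in the regime `G_N ≤ K₀₀`, eventually in `κ`); S1' follows by
  the landed `stub_terminationLocality_of_fluctuationBound` (…StubTerminationLocalityAux8, p126351) and is EQUIVALENT
  to it eventually in `κ` (`fluctuationBound_of_oneBlock`);
* S2'' `stub_farPairingBound` — the FAR-PAIRING ("double escape") BOUND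
  `(γ²/T²)(⟨g_3∘R, V'(r_J)(∂_{p_{N−1}} g_N)∘π_N⟩ − κ⟨g_3∘R, g_N∘π_N⟩) ≤ C₃ K₀₀ K₃₃`, stated as nonemptiness of the landed
  set `bypassFarPairingConstants`; S2' follows by the landed `stub_bypassBound_of_farPairingBound`
  (…StubBypassBoundAux5) and is EQUIVALENT to it (`bypassFarPairingConstants_eq`);
* S3'' `stub_probeRemovalJunctionBounds` — the JUNCTION-PAIRING BOUNDS (J1) ∧ (J2) on the improper junction pairings
  `Π(h, g_a)` of the plain chain's two forward fields against the device's end resolvent fields (wave-1 worker, this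
  seat: four κ-frame probe-removal identities …StubProbeRemovalCostAux3/5, p128494/p128911, with NO regularity
  hypothesis thanks to cutoff-limit pairings); S3' follows by the landed `stub_probeRemovalCost_of_junctionPairingLimBounds`
  (…Aux6, p129033) and is EQUIVALENT to it (`junctionPairingLimBounds_of_stub_probeRemovalCost`).

So the registered stubs of v9 are exactly the irreducible `N`-UNIFORM junction inequalities every leg of this line hinges
on; NOTHING fixed-`N` is left anywhere in the line. The landed S0-layer (plain forward fields p82318, κ-resolvent device fields and
PSD diagonal, plain Kubo link p96859) and the exact algebra (`series_defect_le`, `schur_pos`, `defect_le_of_legs`) are as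
in v7; `SuperadditiveResistance_of` concludes the crux BY NAME with `C = 2C₁ + 2 max(C₃,0) + C₂`. The crux itself is
equivalent to its hypothesis-free Kubo form (`superadditiveResistance_iff_kuboInsertionBound`, p127419).
-/


noncomputable section

open MeasureTheory Filter Topology
open scoped ContDiff
open Literature.MathematicalPhysics.KineticTheory.HeatConduction
open Summit.AtomisticToContinuum.FouriersLaw.Theorems.SuperadditiveResistance.DeviceLiouville
  (kin deviceGenerator)
open Summit.AtomisticToContinuum.FouriersLaw.Theorems.SuperadditiveResistance.Kubo (rev chi)

namespace Summit.AtomisticToContinuum.FouriersLaw.Cruxes.SuperadditiveResistance.FloatingProbeBypassLaplacian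

/-! ## §1 Vocabulary: `plainKubo`, `plainForwardFields`, `deviceResolventFields`, `kuboMatrix`, `termSite` are all imported (landed). -/

/-! ## §2 The registered stubs (S1'', S2'', S3'') and the derived v7 legs (S1', S2', S3') -/

/-- **S1'' — TERMINATION FLUCTUATION BOUND (N-uniform; eventually in `κ`; the lossless reduced form of S1').**
For every split and all small `κ`, for every κ-resolvent family `g` of the device and every plain forward field `g_N`
of the bare left block, in the regime `G_N ≤ K₀₀`:
`(G_N/γ) K₀₁ − (γ²/T²)(S_N + Dyn_N^{fl}(κ)) ≤ C' G_N K₀₀`, where `S_N = terminationStatic` (junction tilt of the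
left-block marginal) and `Dyn_N^{fl}` pairs the reversed device field `g_0∘R` with the junction force times the
FLUCTUATING part `∂_{p_{N−1}} g_N − (G_N/γ²) p_{N−1}` of the bare field's end gradient. -/
theorem stub_terminationFluctuationBound :
    ∀ ω₂ lam β γ T : ℝ, 0 < ω₂ → 0 < lam → 0 < β → 0 < γ → 0 < T →
      ∃ C' : ℝ, ∀ (N M : ℕ) (hN : 2 ≤ N) (hM : 2 ≤ M), ∃ κ₁ : ℝ, 0 < κ₁ ∧ ∀ κ : ℝ, 0 < κ → κ ≤ κ₁ →
        ∀ (g : Fin 4 → PhaseSpace (N + M) → ℝ) (gN : PhaseSpace N → ℝ),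
          (∀ a : Fin 4, g a ∈ deviceResolventFields ω₂ lam β γ T N M (termSite N M a) κ) →
          gN ∈ plainForwardFields ω₂ lam β γ T N →
          plainKubo ω₂ lam β γ T N gN ≤ kuboMatrix ω₂ lam β γ T N M g 0 0 →
          plainKubo ω₂ lam β γ T N gN / γ * kuboMatrix ω₂ lam β γ T N M g 0 1 -
              γ ^ 2 / T ^ 2 * (terminationStatic ω₂ lam β γ T N M gN +
                ∫ x, g 0 (x.1, -x.2) * (junctionForce β (show 1 ≤ N by omega) (show 1 ≤ M by omega) x *
                  (partialP ⟨N - 1, by omega⟩ gN (x.1 ∘ Fin.castAdd M, x.2 ∘ Fin.castAdd M) -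
                    plainKubo ω₂ lam β γ T N gN / γ ^ 2 * x.2 ⟨N - 1, by omega⟩))
                  ∂((pinnedChain ω₂ lam β γ).gibbsMeasure (N + M) T)) ≤
            C' * plainKubo ω₂ lam β γ T N gN * kuboMatrix ω₂ lam β γ T N M g 0 0 := by
  sorry

/-- **S2'' — FAR-PAIRING (double-escape) BOUND (N-uniform; eventually in `κ`; the lossless reduced form of S2').**
Some constant `C₃` is an admissible far-pairing constant:
`(γ²/T²)(⟨g_3∘R, V'(r_J)(∂_{p_{N−1}} g_N)∘π_N⟩ − κ⟨g_3∘R, g_N∘π_N⟩) ≤ C₃ K₀₀ K₃₃` for all splits, all small `κ`, all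
resolvent families and all plain forward fields of the left block (the landed set `bypassFarPairingConstants`). -/
theorem stub_farPairingBound :
    ∀ ω₂ lam β γ T : ℝ, 0 < ω₂ → 0 < lam → 0 < β → 0 < γ → 0 < T →
      (bypassFarPairingConstants ω₂ lam β γ T).Nonempty := by
  sorry

/-- **S1' (v7 leg, now DERIVED) — termination locality, one block each side, division-free:**
`K₀₀ − G_N ≤ C₁ G_N K₀₀` and `K₃₃ − G_M ≤ C₁ G_M K₃₃` eventually in `κ`; from S1'' by the landed reduction
`stub_terminationLocality_of_fluctuationBound` (block swap for the right clause included there). -/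
theorem terminationLocality_of_stub :
    ∀ ω₂ lam β γ T : ℝ, 0 < ω₂ → 0 < lam → 0 < β → 0 < γ → 0 < T →
      ∃ C₁ : ℝ, ∀ N M : ℕ, 2 ≤ N → 2 ≤ M → ∃ κ₁ : ℝ, 0 < κ₁ ∧ ∀ κ : ℝ, 0 < κ → κ ≤ κ₁ →
        ∀ (g : Fin 4 → PhaseSpace (N + M) → ℝ) (gN : PhaseSpace N → ℝ) (gM : PhaseSpace M → ℝ),
          (∀ a : Fin 4, g a ∈ deviceResolventFields ω₂ lam β γ T N M (termSite N M a) κ) →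
          gN ∈ plainForwardFields ω₂ lam β γ T N → gM ∈ plainForwardFields ω₂ lam β γ T M →
          kuboMatrix ω₂ lam β γ T N M g 0 0 - plainKubo ω₂ lam β γ T N gN ≤
              C₁ * plainKubo ω₂ lam β γ T N gN * kuboMatrix ω₂ lam β γ T N M g 0 0 ∧
            kuboMatrix ω₂ lam β γ T N M g 3 3 - plainKubo ω₂ lam β γ T M gM ≤
              C₁ * plainKubo ω₂ lam β γ T M gM * kuboMatrix ω₂ lam β γ T N M g 3 3 :=
  fun ω₂ lam β γ T hω hl hβ hγ hT =>
    stub_terminationLocality_of_fluctuationBound ω₂ lam β γ T hω hl hβ hγ hT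
      (stub_terminationFluctuationBound ω₂ lam β γ T hω hl hβ hγ hT)

/-- **S2' (v7 leg, now DERIVED) — bypass bound** `−K₀₃ ≤ C₃ K₀₀ K₃₃` eventually in `κ`; from S2'' by the landed
`stub_bypassBound_of_farPairingBound`. -/
theorem bypassBound_of_stub :
    ∀ ω₂ lam β γ T : ℝ, 0 < ω₂ → 0 < lam → 0 < β → 0 < γ → 0 < T →
      ∃ C₃ : ℝ, ∀ N M : ℕ, 2 ≤ N → 2 ≤ M → ∃ κ₃ : ℝ, 0 < κ₃ ∧ ∀ κ : ℝ, 0 < κ → κ ≤ κ₃ →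
        ∀ g : Fin 4 → PhaseSpace (N + M) → ℝ,
          (∀ a : Fin 4, g a ∈ deviceResolventFields ω₂ lam β γ T N M (termSite N M a) κ) →
          -(kuboMatrix ω₂ lam β γ T N M g 0 3) ≤
            C₃ * kuboMatrix ω₂ lam β γ T N M g 0 0 * kuboMatrix ω₂ lam β γ T N M g 3 3 :=
  fun ω₂ lam β γ T hω hl hβ hγ hT =>
    stub_bypassBound_of_farPairingBound ω₂ lam β γ T hω hl hβ hγ hT
      (stub_farPairingBound ω₂ lam β γ T hω hl hβ hγ hT)

/-- **S3'' — PROBE-REMOVAL JUNCTION BOUNDS (N-uniform; eventually in `κ`; the lossless reduced form of S3').**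
With the improper junction pairing `Π(h, g) := κ⟨h∘R, g⟩ + γT·lim_n Σ_{s∈{N−1,N}} ∫ χ_n ∂_{p_s}(h∘R) ∂_{p_s} g dμ_T`
(cutoff limit; it exists unconditionally, `…StubProbeRemovalCostAux5`), `Π_L0 = Π(gL, g 0)`, `Π_R3 = Π(gL∘S, g 3)`,
`Π_R0 = Π(gL∘S, g 0)` (`S` = site reflection), `c = γ²/T²`, `G_L = plainKubo … gL`:
(J1) `c(Π_R0² − Π_L0 Π_R3)(1 + C₂ G_L) ≤ C₂ G_L² (Π_L0 + Π_R3 + 2Π_R0)` (second-order cancellation in the cross-Gram of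
`{gL, gL∘S}` against `{g 0, g 3}`; exact equality in a resistor caricature) and
(J2) `G_L ≤ C₂ c (Π_L0 + Π_R3 + 2Π_R0)` (connectivity margin: probe transfer ≥ G_{N+M}/C₂ eventually in κ). -/
theorem stub_probeRemovalJunctionBounds :
    ∀ ω₂ lam β γ T : ℝ, 0 < ω₂ → 0 < lam → 0 < β → 0 < γ → 0 < T →
      ∃ C₂ : ℝ, 0 < C₂ ∧ ∀ (N M : ℕ) (hN : 2 ≤ N) (hM : 2 ≤ M), ∃ κ₂ : ℝ, 0 < κ₂ ∧ ∀ κ : ℝ, 0 < κ → κ ≤ κ₂ →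
        ∀ (g : Fin 4 → PhaseSpace (N + M) → ℝ) (gL : PhaseSpace (N + M) → ℝ),
          (∀ a : Fin 4, g a ∈ deviceResolventFields ω₂ lam β γ T N M (termSite N M a) κ) →
          gL ∈ plainForwardFields ω₂ lam β γ T (N + M) →
          γ ^ 2 / T ^ 2 *
                ((κ * ∫ x, (gL ∘ siteReflection (N + M)) (x.1, -x.2) * g 0 x ∂((pinnedChain ω₂ lam β γ).gibbsMeasure (N + M) T) +
                  γ * T * limUnder atTop (fun n : ℕ =>
                    ((∫ x, chi (pinnedChain ω₂ lam β γ) (N + M) n x * (partialP ⟨N - 1, by omega⟩ (fun y : PhaseSpace (N + M) => (gL ∘ siteReflection (N + M)) (y.1, -y.2)) x * partialP ⟨N - 1, by omega⟩ (g 0) x) ∂((pinnedChain ω₂ lam β γ).gibbsMeasure (N + M) T)) +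
                      ∫ x, chi (pinnedChain ω₂ lam β γ) (N + M) n x * (partialP ⟨N, by omega⟩ (fun y : PhaseSpace (N + M) => (gL ∘ siteReflection (N + M)) (y.1, -y.2)) x * partialP ⟨N, by omega⟩ (g 0) x) ∂((pinnedChain ω₂ lam β γ).gibbsMeasure (N + M) T)))) ^ 2 -
                (κ * ∫ x, gL (x.1, -x.2) * g 0 x ∂((pinnedChain ω₂ lam β γ).gibbsMeasure (N + M) T) +
                  γ * T * limUnder atTop (fun n : ℕ =>
                    ((∫ x, chi (pinnedChain ω₂ lam β γ) (N + M) n x * (partialP ⟨N - 1, by omega⟩ (fun y : PhaseSpace (N + M) => gL (y.1, -y.2)) x * partialP ⟨N - 1, by omega⟩ (g 0) x) ∂((pinnedChain ω₂ lam β γ).gibbsMeasure (N + M) T)) +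
                      ∫ x, chi (pinnedChain ω₂ lam β γ) (N + M) n x * (partialP ⟨N, by omega⟩ (fun y : PhaseSpace (N + M) => gL (y.1, -y.2)) x * partialP ⟨N, by omega⟩ (g 0) x) ∂((pinnedChain ω₂ lam β γ).gibbsMeasure (N + M) T)))) *
                (κ * ∫ x, (gL ∘ siteReflection (N + M)) (x.1, -x.2) * g 3 x ∂((pinnedChain ω₂ lam β γ).gibbsMeasure (N + M) T) +
                  γ * T * limUnder atTop (fun n : ℕ =>
                    ((∫ x, chi (pinnedChain ω₂ lam β γ) (N + M) n x * (partialP ⟨N - 1, by omega⟩ (fun y : PhaseSpace (N + M) => (gL ∘ siteReflection (N + M)) (y.1, -y.2)) x * partialP ⟨N - 1, by omega⟩ (g 3) x) ∂((pinnedChain ω₂ lam β γ).gibbsMeasure (N + M) T)) +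
                      ∫ x, chi (pinnedChain ω₂ lam β γ) (N + M) n x * (partialP ⟨N, by omega⟩ (fun y : PhaseSpace (N + M) => (gL ∘ siteReflection (N + M)) (y.1, -y.2)) x * partialP ⟨N, by omega⟩ (g 3) x) ∂((pinnedChain ω₂ lam β γ).gibbsMeasure (N + M) T))))) *
              (1 + C₂ * plainKubo ω₂ lam β γ T (N + M) gL) ≤
            C₂ * plainKubo ω₂ lam β γ T (N + M) gL ^ 2 *
              ((κ * ∫ x, gL (x.1, -x.2) * g 0 x ∂((pinnedChain ω₂ lam β γ).gibbsMeasure (N + M) T) +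
                  γ * T * limUnder atTop (fun n : ℕ =>
                    ((∫ x, chi (pinnedChain ω₂ lam β γ) (N + M) n x * (partialP ⟨N - 1, by omega⟩ (fun y : PhaseSpace (N + M) => gL (y.1, -y.2)) x * partialP ⟨N - 1, by omega⟩ (g 0) x) ∂((pinnedChain ω₂ lam β γ).gibbsMeasure (N + M) T)) +
                      ∫ x, chi (pinnedChain ω₂ lam β γ) (N + M) n x * (partialP ⟨N, by omega⟩ (fun y : PhaseSpace (N + M) => gL (y.1, -y.2)) x * partialP ⟨N, by omega⟩ (g 0) x) ∂((pinnedChain ω₂ lam β γ).gibbsMeasure (N + M) T)))) +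
                (κ * ∫ x, (gL ∘ siteReflection (N + M)) (x.1, -x.2) * g 3 x ∂((pinnedChain ω₂ lam β γ).gibbsMeasure (N + M) T) +
                  γ * T * limUnder atTop (fun n : ℕ =>
                    ((∫ x, chi (pinnedChain ω₂ lam β γ) (N + M) n x * (partialP ⟨N - 1, by omega⟩ (fun y : PhaseSpace (N + M) => (gL ∘ siteReflection (N + M)) (y.1, -y.2)) x * partialP ⟨N - 1, by omega⟩ (g 3) x) ∂((pinnedChain ω₂ lam β γ).gibbsMeasure (N + M) T)) +
                      ∫ x, chi (pinnedChain ω₂ lam β γ) (N + M) n x * (partialP ⟨N, by omega⟩ (fun y : PhaseSpace (N + M) => (gL ∘ siteReflection (N + M)) (y.1, -y.2)) x * partialP ⟨N, by omega⟩ (g 3) x) ∂((pinnedChain ω₂ lam β γ).gibbsMeasure (N + M) T)))) +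
                2 * (κ * ∫ x, (gL ∘ siteReflection (N + M)) (x.1, -x.2) * g 0 x ∂((pinnedChain ω₂ lam β γ).gibbsMeasure (N + M) T) +
                  γ * T * limUnder atTop (fun n : ℕ =>
                    ((∫ x, chi (pinnedChain ω₂ lam β γ) (N + M) n x * (partialP ⟨N - 1, by omega⟩ (fun y : PhaseSpace (N + M) => (gL ∘ siteReflection (N + M)) (y.1, -y.2)) x * partialP ⟨N - 1, by omega⟩ (g 0) x) ∂((pinnedChain ω₂ lam β γ).gibbsMeasure (N + M) T)) +
                      ∫ x, chi (pinnedChain ω₂ lam β γ) (N + M) n x * (partialP ⟨N, by omega⟩ (fun y : PhaseSpace (N + M) => (gL ∘ siteReflection (N + M)) (y.1, -y.2)) x * partialP ⟨N, by omega⟩ (g 0) x) ∂((pinnedChain ω₂ lam β γ).gibbsMeasure (N + M) T))))) ∧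
          plainKubo ω₂ lam β γ T (N + M) gL ≤ C₂ * (γ ^ 2 / T ^ 2) *
            ((κ * ∫ x, gL (x.1, -x.2) * g 0 x ∂((pinnedChain ω₂ lam β γ).gibbsMeasure (N + M) T) +
                γ * T * limUnder atTop (fun n : ℕ =>
                  ((∫ x, chi (pinnedChain ω₂ lam β γ) (N + M) n x * (partialP ⟨N - 1, by omega⟩ (fun y : PhaseSpace (N + M) => gL (y.1, -y.2)) x * partialP ⟨N - 1, by omega⟩ (g 0) x) ∂((pinnedChain ω₂ lam β γ).gibbsMeasure (N + M) T)) +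
                    ∫ x, chi (pinnedChain ω₂ lam β γ) (N + M) n x * (partialP ⟨N, by omega⟩ (fun y : PhaseSpace (N + M) => gL (y.1, -y.2)) x * partialP ⟨N, by omega⟩ (g 0) x) ∂((pinnedChain ω₂ lam β γ).gibbsMeasure (N + M) T)))) +
              (κ * ∫ x, (gL ∘ siteReflection (N + M)) (x.1, -x.2) * g 3 x ∂((pinnedChain ω₂ lam β γ).gibbsMeasure (N + M) T) +
                γ * T * limUnder atTop (fun n : ℕ =>
                  ((∫ x, chi (pinnedChain ω₂ lam β γ) (N + M) n x * (partialP ⟨N - 1, by omega⟩ (fun y : PhaseSpace (N + M) => (gL ∘ siteReflection (N + M)) (y.1, -y.2)) x * partialP ⟨N - 1, by omega⟩ (g 3) x) ∂((pinnedChain ω₂ lam β γ).gibbsMeasure (N + M) T)) +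
                    ∫ x, chi (pinnedChain ω₂ lam β γ) (N + M) n x * (partialP ⟨N, by omega⟩ (fun y : PhaseSpace (N + M) => (gL ∘ siteReflection (N + M)) (y.1, -y.2)) x * partialP ⟨N, by omega⟩ (g 3) x) ∂((pinnedChain ω₂ lam β γ).gibbsMeasure (N + M) T)))) +
              2 * (κ * ∫ x, (gL ∘ siteReflection (N + M)) (x.1, -x.2) * g 0 x ∂((pinnedChain ω₂ lam β γ).gibbsMeasure (N + M) T) +
                γ * T * limUnder atTop (fun n : ℕ =>
                  ((∫ x, chi (pinnedChain ω₂ lam β γ) (N + M) n x * (partialP ⟨N - 1, by omega⟩ (fun y : PhaseSpace (N + M) => (gL ∘ siteReflection (N + M)) (y.1, -y.2)) x * partialP ⟨N - 1, by omega⟩ (g 0) x) ∂((pinnedChain ω₂ lam β γ).gibbsMeasure (N + M) T)) +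
                    ∫ x, chi (pinnedChain ω₂ lam β γ) (N + M) n x * (partialP ⟨N, by omega⟩ (fun y : PhaseSpace (N + M) => (gL ∘ siteReflection (N + M)) (y.1, -y.2)) x * partialP ⟨N, by omega⟩ (g 0) x) ∂((pinnedChain ω₂ lam β γ).gibbsMeasure (N + M) T))))) := by
  sorry

/-- **S3' (v7/v8 leg, now DERIVED) — probe-removal cost in Schur variables + connectivity margin**, eventually in `κ`;
from S3'' by the landed hypothesis-free lossless reduction `stub_probeRemovalCost_of_junctionPairingLimBounds`
(…StubProbeRemovalCostAux6, p129033; converse `junctionPairingLimBounds_of_stub_probeRemovalCost`). -/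
theorem probeRemovalCost_of_stub :
    ∀ ω₂ lam β γ T : ℝ, 0 < ω₂ → 0 < lam → 0 < β → 0 < γ → 0 < T →
      ∃ C₂ : ℝ, 0 < C₂ ∧ ∀ N M : ℕ, 2 ≤ N → 2 ≤ M → ∃ κ₂ : ℝ, 0 < κ₂ ∧ ∀ κ : ℝ, 0 < κ → κ ≤ κ₂ →
        ∀ (g : Fin 4 → PhaseSpace (N + M) → ℝ) (gL : PhaseSpace (N + M) → ℝ),
          (∀ a : Fin 4, g a ∈ deviceResolventFields ω₂ lam β γ T N M (termSite N M a) κ) →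
          gL ∈ plainForwardFields ω₂ lam β γ T (N + M) →
          plainKubo ω₂ lam β γ T (N + M) gL *
              (kuboMatrix ω₂ lam β γ T N M g 0 0 + kuboMatrix ω₂ lam β γ T N M g 3 3 +
                2 * kuboMatrix ω₂ lam β γ T N M g 0 3) ≤
            (kuboMatrix ω₂ lam β γ T N M g 0 0 * kuboMatrix ω₂ lam β γ T N M g 3 3 -
                (kuboMatrix ω₂ lam β γ T N M g 0 3) ^ 2) * (1 + C₂ * plainKubo ω₂ lam β γ T (N + M) gL) ∧
          plainKubo ω₂ lam β γ T (N + M) gL ≤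
            C₂ * (kuboMatrix ω₂ lam β γ T N M g 0 0 + kuboMatrix ω₂ lam β γ T N M g 3 3 +
              2 * kuboMatrix ω₂ lam β γ T N M g 0 3) :=
  fun ω₂ lam β γ T hω hl hβ hγ hT =>
    stub_probeRemovalCost_of_junctionPairingLimBounds ω₂ lam β γ T hω hl hβ hγ hT
      (stub_probeRemovalJunctionBounds ω₂ lam β γ T hω hl hβ hγ hT)

/-! ## §3 The exact algebra (sorry-free; from v3 plus the Schur-variable nondegeneracy) -/

/-- **Series defect of a floating node (pure real algebra).** -/
theorem series_defect_le {a b x C₃ : ℝ} (ha : 0 < a) (hb : 0 < b) (hmin : x ^ 2 < a * b)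
    (hx : x ≤ C₃ * a * b) :
    1 / a + 1 / b - (a + b - 2 * x) / (a * b - x ^ 2) ≤ 2 * max C₃ 0 := by
  have hd : 0 < a * b - x ^ 2 := by linarith
  have hab : 0 < a * b := mul_pos ha hb
  have key : 1 / a + 1 / b - (a + b - 2 * x) / (a * b - x ^ 2) =
      x * (2 * a * b - (a + b) * x) / (a * b * (a * b - x ^ 2)) := by
    field_simp
    ring
  rw [key]
  rcases le_or_gt x 0 with hx0 | hx0
  · have hnum : x * (2 * a * b - (a + b) * x) ≤ 0 := by
      have : 0 ≤ 2 * a * b - (a + b) * x := by nlinarith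
      exact mul_nonpos_of_nonpos_of_nonneg hx0 this
    have : x * (2 * a * b - (a + b) * x) / (a * b * (a * b - x ^ 2)) ≤ 0 :=
      div_nonpos_of_nonpos_of_nonneg hnum (by positivity)
    have hmax : (0 : ℝ) ≤ 2 * max C₃ 0 := by positivity
    linarith
  · have h2x : 2 * x < a + b := by nlinarith [sq_nonneg (a - b), sq_abs x]
    have hstep : x * (2 * a * b - (a + b) * x) / (a * b * (a * b - x ^ 2)) ≤ 2 * x / (a * b) := by
      rw [div_le_div_iff₀ (by positivity) hab]
      have hid : 2 * x * (a * b * (a * b - x ^ 2)) - x * (2 * a * b - (a + b) * x) * (a * b)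
          = x ^ 2 * (a * b) * (a + b - 2 * x) := by ring
      have hnn : 0 ≤ x ^ 2 * (a * b) * (a + b - 2 * x) :=
        mul_nonneg (mul_nonneg (sq_nonneg x) hab.le) (by linarith)
      linarith
    have hC : x / (a * b) ≤ C₃ := by
      rw [div_le_iff₀ hab]; linarith
    have hmax : C₃ ≤ max C₃ 0 := le_max_left _ _
    have : 2 * x / (a * b) = 2 * (x / (a * b)) := by ring
    linarith

/-- **From the division-free termination bound to the resistance form (pure real algebra).** -/
theorem one_div_sub_one_div_le {G K C : ℝ} (hG : 0 < G) (hK : 0 < K) (h : K - G ≤ C * G * K) :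
    1 / G - 1 / K ≤ C := by
  have hGK : 0 < G * K := mul_pos hG hK
  have e : 1 / G - 1 / K = (K - G) / (G * K) := by field_simp
  rw [e, div_le_iff₀ hGK]
  linarith

/-- **Four-term decomposition ⇒ superadditivity defect bound (pure real algebra).** -/
theorem defect_le_of_legs {RN RM RL a b x C₁ C₂ C₃ : ℝ} (ha : 0 < a) (hb : 0 < b) (hmin : x ^ 2 < a * b)
    (h₁ : RN - 1 / a ≤ C₁) (h₂ : RM - 1 / b ≤ C₁) (h₃ : x ≤ C₃ * a * b)
    (h₄ : (a + b - 2 * x) / (a * b - x ^ 2) - RL ≤ C₂) :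
    RN + RM - (2 * C₁ + 2 * max C₃ 0 + C₂) ≤ RL := by
  have hs := series_defect_le ha hb hmin h₃
  linarith

/-- **Nondegeneracy from the Schur-variable probe bound (pure real algebra).** -/
theorem schur_pos {a b x G C : ℝ} (hG : 0 < G) (hC : 0 < C) (ha : 0 ≤ a)
    (h1 : G * (a + b - 2 * x) ≤ (a * b - x ^ 2) * (1 + C * G)) (h2 : G ≤ C * (a + b - 2 * x)) :
    0 < a ∧ 0 < b ∧ x ^ 2 < a * b ∧ (a + b - 2 * x) / (a * b - x ^ 2) - 1 / G ≤ C := by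
  have hBv : 0 < a + b - 2 * x := by
    by_contra hle
    have hle' : a + b - 2 * x ≤ 0 := le_of_not_gt hle
    have : C * (a + b - 2 * x) ≤ 0 := mul_nonpos_of_nonneg_of_nonpos hC.le hle'
    linarith
  have hpos : 0 < 1 + C * G := by positivity
  have hA : 0 < a * b - x ^ 2 := by
    have h0 : 0 < G * (a + b - 2 * x) := mul_pos hG hBv
    exact (mul_pos_iff_of_pos_right hpos).mp (lt_of_lt_of_le h0 h1)
  have hab : 0 < a * b := by nlinarith [sq_nonneg x]
  have ha' : 0 < a := by
    rcases ha.lt_or_eq with hlt | heq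
    · exact hlt
    · exfalso; rw [← heq, zero_mul] at hab; exact lt_irrefl _ hab
  have hb' : 0 < b := pos_of_mul_pos_right hab ha'.le
  refine ⟨ha', hb', by linarith, ?_⟩
  have e : (a + b - 2 * x) / (a * b - x ^ 2) - 1 / G =
      (G * (a + b - 2 * x) - (a * b - x ^ 2)) / ((a * b - x ^ 2) * G) := by
    field_simp
  rw [e, div_le_iff₀ (mul_pos hA hG)]
  nlinarith

/-! ## §4 Kernel-checked composition: S1''/S2''/S3'' (through the derived S1'/S2'/S3') and the landed S0-layer prove the crux BY NAME -/

/-- **The line closes the crux (κ-frame).** S0a gives left forward fields of the bare `N`-, `M`-, `(N+M)`-chains,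
S0c identifies `D_L/(L−1)` with their Kubo conductances; S1', S2', S3' give `C₁, C₃, C₂` and thresholds
`κ₁, κ₃, κ₂` for the split; at `κ = min κᵢ` S0b' gives a resolvent family, S0d' the sign of the diagonal,
`schur_pos` the nondegeneracy, and `defect_le_of_legs` yields `R_N + R_M − (2C₁ + 2max(C₃,0) + C₂) ≤ R_{N+M}`. -/
theorem SuperadditiveResistance_of :
    Summit.AtomisticToContinuum.FouriersLaw.Theses.JunctionLocality.SuperadditiveResistance := by
  intro ω₂ lam β γ hω hl hβ hγ hU μ hμ T hT D hD hpos
  obtain ⟨C₁, hC₁⟩ := terminationLocality_of_stub ω₂ lam β γ T hω hl hβ hγ hT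
  obtain ⟨C₃, hC₃⟩ := bypassBound_of_stub ω₂ lam β γ T hω hl hβ hγ hT
  obtain ⟨C₂, hC₂pos, hC₂⟩ := probeRemovalCost_of_stub ω₂ lam β γ T hω hl hβ hγ hT
  refine ⟨2 * C₁ + 2 * max C₃ 0 + C₂, fun N M hN hM => ?_⟩
  -- S0a: forward fields of the pieces and of the whole (κ = 0 side)
  obtain ⟨gN, hgN⟩ := stub_plainForwardField ω₂ lam β γ T hω hl hβ hγ hT N hN
  obtain ⟨gM, hgM⟩ := stub_plainForwardField ω₂ lam β γ T hω hl hβ hγ hT M hM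
  obtain ⟨gL, hgL⟩ := stub_plainForwardField ω₂ lam β γ T hω hl hβ hγ hT (N + M) (by omega)
  -- S0c: the Kubo link for the three bare chains
  have kN := stub_plainKuboLink ω₂ lam β γ μ T D hω hl hβ hγ hT hU hμ hD hpos N hN gN hgN
  have kM := stub_plainKuboLink ω₂ lam β γ μ T D hω hl hβ hγ hT hU hμ hD hpos M hM gM hgM
  have kL := stub_plainKuboLink ω₂ lam β γ μ T D hω hl hβ hγ hT hU hμ hD hpos (N + M) (by omega) gL hgL
  have hcast : ((N + M : ℕ) : ℝ) - 1 = (N : ℝ) + (M : ℝ) - 1 := by push_cast; ring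
  rw [hcast] at kL
  -- thresholds of the legs for this split and one admissible κ
  obtain ⟨κ₁, hκ₁, h1⟩ := hC₁ N M hN hM
  obtain ⟨κ₃, hκ₃, h3⟩ := hC₃ N M hN hM
  obtain ⟨κ₂, hκ₂, h2⟩ := hC₂ N M hN hM
  set κ : ℝ := min (min κ₁ κ₂) κ₃ with hκdef
  have hκ : 0 < κ := lt_min (lt_min hκ₁ hκ₂) hκ₃
  have hκle₁ : κ ≤ κ₁ := le_trans (min_le_left _ _) (min_le_left _ _)
  have hκle₂ : κ ≤ κ₂ := le_trans (min_le_left _ _) (min_le_right _ _)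
  have hκle₃ : κ ≤ κ₃ := min_le_right _ _
  -- S0b': a resolvent family at κ; S0d': sign of the diagonal
  obtain ⟨g, hg⟩ := stub_deviceResolventFields ω₂ lam β γ T hω hl hβ hγ hT N M hN hM κ hκ
  have ha0 := stub_kuboDiagNonneg ω₂ lam β γ T hω hl hβ hγ hT N M hN hM κ hκ g hg 0
  -- the legs at κ
  obtain ⟨h₁', h₂'⟩ := h1 κ hκ hκle₁ g gN gM hg hgN hgM
  have h₃ := h3 κ hκ hκle₃ g hg
  obtain ⟨h₄a, h₄b⟩ := h2 κ hκ hκle₂ g gL hg hgL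
  set K := kuboMatrix ω₂ lam β γ T N M g with hK
  -- positivity of the plain Kubo conductances through the Kubo link and the crux's D > 0
  have hN' : (0 : ℝ) < (N : ℝ) - 1 := by
    have : (2 : ℝ) ≤ (N : ℝ) := by exact_mod_cast hN
    linarith
  have hM' : (0 : ℝ) < (M : ℝ) - 1 := by
    have : (2 : ℝ) ≤ (M : ℝ) := by exact_mod_cast hM
    linarith
  have hL' : (0 : ℝ) < (N : ℝ) + (M : ℝ) - 1 := by linarith
  have hGN : 0 < plainKubo ω₂ lam β γ T N gN := by rw [← kN]; exact div_pos (hpos N hN) hN'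
  have hGM : 0 < plainKubo ω₂ lam β γ T M gM := by rw [← kM]; exact div_pos (hpos M hM) hM'
  have hGL : 0 < plainKubo ω₂ lam β γ T (N + M) gL := by
    rw [← kL]; exact div_pos (hpos (N + M) (by omega)) hL'
  -- nondegeneracy and the resistance forms
  have e1 : K 0 0 + K 3 3 - 2 * (-(K 0 3)) = K 0 0 + K 3 3 + 2 * K 0 3 := by ring
  have e2 : (-(K 0 3)) ^ 2 = (K 0 3) ^ 2 := by ring
  have h₄a' : plainKubo ω₂ lam β γ T (N + M) gL * (K 0 0 + K 3 3 - 2 * (-(K 0 3))) ≤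
      (K 0 0 * K 3 3 - (-(K 0 3)) ^ 2) * (1 + C₂ * plainKubo ω₂ lam β γ T (N + M) gL) := by
    rw [e1, e2]; exact h₄a
  have h₄b' : plainKubo ω₂ lam β γ T (N + M) gL ≤ C₂ * (K 0 0 + K 3 3 - 2 * (-(K 0 3))) := by
    rw [e1]; exact h₄b
  obtain ⟨ha, hb, hmin, h₄⟩ := schur_pos hGL hC₂pos ha0 h₄a' h₄b'
  have h₁ := one_div_sub_one_div_le hGN ha h₁'
  have h₂ := one_div_sub_one_div_le hGM hb h₂'
  -- resistances of the pieces and of the whole in Kubo form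
  have rN : ((N : ℝ) - 1) / D N = 1 / plainKubo ω₂ lam β γ T N gN := by rw [← kN, one_div_div]
  have rM : ((M : ℝ) - 1) / D M = 1 / plainKubo ω₂ lam β γ T M gM := by rw [← kM, one_div_div]
  have rL : ((N : ℝ) + (M : ℝ) - 1) / D (N + M) = 1 / plainKubo ω₂ lam β γ T (N + M) gL := by
    rw [← kL, one_div_div]
  rw [rN, rM, rL]
  exact defect_le_of_legs ha hb hmin h₁ h₂ h₃ h₄

end Summit.AtomisticToContinuum.FouriersLaw.Cruxes.SuperadditiveResistance.FloatingProbeBypassLaplacian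

end
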